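import Literature.IUT.HodgeArakelov.MonoThetaFromGroups
import Literature.AnabelianGeometry.EtaleTheta.FrobenioidMonoThetaEnv
import HarnessLib

/-!
# [IUTchII] Proposition 1.3 (i)–(iii): discharge census over the [EtTh] §5 tempered-Frobenioid data

S. Mochizuki, *Inter-universal Teichmüller theory II*, §1, Proposition 1.3 "(Compatibility of Cyclotomic
Rigidity Isomorphisms)", kurims manuscript (Dec. 2020) pp. 26–27 (read on the page, `paper:url-5036b4059555`
p. 26 l. 10 – p. 27 l. 8). PROOF-ONLY companion (abc-iut cell, wave-4 discharge seat abc-iut-w4-d042; nodes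
`IUTchII:Prop1.3(i)`, `IUTchII:Prop1.3(ii)`, `IUTchII:Prop1.3(iii)`) of abc-iut-L6-t1's
`Literature/IUT/HodgeArakelov/MonoThetaFromGroups.lean` (p406189), which types Prop. 1.3 as the DATA
`FrobenioidCyclotomes` / `BsGalData` over a Prop. 1.2 (ii) output `E : EnvOfFrobenioid F`, the DEFINED
isomorphisms `FrobenioidCyclotomes.monoTheta` (`(*mono-Θ)`) and `BsGalData.bsGal` (`(*bs-Gal)`), and the
predicates `Prop13_i_ii`, `Prop13_iii`. Nothing in that file is edited or restated; no `def … : Prop` is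
introduced here (D-0067 (1)); every declaration below is a `theorem`.

The printed proof (p. 27): "Assertions (i), (ii) follow immediately from the results and definitions of
[EtTh], [AbsTopIII] that are quoted in the statements of these assertions. Assertion (iii) follows
immediately from the fact that in the situation where the Frobenioid `𝒞` involved is not just 'some
abstract category', but rather arises from familiar objects of scheme theory [cf. the theory of [EtTh],
§1!], both isomorphisms `(*mono-Θ)`, `(*bs-Gal)` coincide with the conventional identification between the
cyclotomes involved that arises from conventional scheme theory."

Per-node outcome (plan/L6/DISCHARGE-L6.md vocabulary; MERGE-MAP §2 row "MonoThetaFromGroups.lean:148,:166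
… IMPORT/BRIDGE: Prop 1.3 (i)'s Frobenioid-theoretic cyclotomes = L2-t4's `ThetaFrobenioid.muTorsion S N` /
`lDeltaObj`"):

* **IUTchII:Prop1.3(i)** "the interior cyclotome `(l·Δ_Θ)(M^Θ(𝒞)) ⊗ (ℤ/Nℤ)` corresponds to a certain
  subquotient of `Aut(S^bs)` … `(l·Δ_Θ)_S ⊗ (ℤ/Nℤ)`, while the exterior cyclotome `Π_μ(M^Θ(𝒞))` corresponds
  to the subgroup `μ_N(S) ⊆ O^×(S) ⊆ Aut(S)`" — PROVED HERE in the shape the [EtTh] §5 files of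
  abc-iut-L2-t4 give it (`FrobenioidTheta`, `FrobenioidCyclotomicRigidity`, `FrobenioidMonoThetaEnv`):
  (a) `subquotient_of_projection` — a subgroup `P ⊆ Aut(S^bs)` with a surjection `P ↠ L` (L2-t4's
  `ThetaSubquotientProj`: "the preimage `P_E ⊆ Aut_D(E)` of `(l·Δ_Θ)_E` and the projection `P_E ↠ (l·Δ_Θ)_E`",
  [EtTh] p. 327) IS a `Subquotient (Aut S^bs)` in abc-iut-L6-t1's sense with carrier `≃* L`;
  (b) `exists_kerToPiY_mulEquiv_muTorsion` — for the §5 group `E^Π_N` the exterior cyclotome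
  `Ker(E^Π_N ↠ Π^tp_Y̲)` IS `μ_N(B_N) ⊆ O^×(B_N) ⊆ Aut_𝒞(B_N)` (L2-t4's PROVED `toPiY_ker`, "the distinct
  cyclotome", [EtTh] Rmk. 5.10.3), as a group isomorphism compatible with `u ↦ (u, 1)`;
  (c) `prop13_i_ii_of_cyclotome_data` / `prop13_i_ii_of_thetaFrobenioid` /
  `prop13_i_ii_of_thetaSubquotientProj` (the last one SOURCES the subquotient from L2-t4's
  `ThetaSubquotientProj 𝔉` at `B_N^bs`) — whence `Prop13_i_ii E` for every
  Prop. 1.2 (ii) output `E` whose exterior cyclotome is identified with `Ker(E^Π_N ↠ Π^tp_Y̲)` (this is what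
  "`M^Θ(𝒞)` constructed from `𝒞`", [EtTh] Thm. 5.10 (iii) / Lemma 5.9 (iv), supplies) and whose interior
  cyclotome mod `N` is identified with `(l·Δ_Θ)_{B_N} ⊗ ℤ/Nℤ` (PARAMETER `ψ`: the [EtTh] §2 ↔ §5 identification
  of `(l·Δ_Θ)`, owner abc-iut-L2-t2 — `TODO-merge`), GIVEN the [AbsTopIII] comparison data of (ii).
  "In particular, the cyclotomic rigidity isomorphism of Definition 1.1, (ii), takes the form of an
  isomorphism `(l·Δ_Θ)_S ⊗ (ℤ/Nℤ) ⥲ μ_N(S)`": ALREADY (t1's DEFINED `FrobenioidCyclotomes.monoTheta`); its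
  reading in `𝒞`'s own cyclotomes is `monoTheta_read_eq` below.
* **IUTchII:Prop1.3(ii)** "(MLF-Galois Pairs)" — the typed content is DATA (`BsGalData`: three mod-`N`
  cyclotomes of [AbsTopIII] with the natural isomorphisms of Cor. 1.10 (c) and Rmk. 3.2.1 and the two
  correspondences) and the DEFINED composite `bsGal`. Recorded limitation (not repairable here): the tree's
  [AbsTopIII] Cor. 1.10 (ii)(c) (`AbsoluteAnabelian.CurveModel.Cor_1_10_ii_c`, abc-iut-L4) asserts only the
  EXISTENCE of an equivariant `μ_Ẑ(G_k) ≅ μ_Ẑ(Π_X)` and does not single out the NATURAL one, so the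
  [AbsTopIII]-side inputs enter the theorems below as explicit parameters (`i₁`, `i₂`, `c₁`, `c₂`), never
  asserted; MERGE-MAP: "WAIT(L4-t1 Reconstruction)".
* **IUTchII:Prop1.3(iii)** "(Compatibility) … `(*mono-Θ)`, `(*bs-Gal)` … coincide" — the printed inference
  PROVED in two forms: `prop13_iii_of_conventional` (both isomorphisms agree with one "conventional
  identification" of the two cyclotomes with a reference cyclotome ⇒ they coincide — exactly the sentence of
  p. 27), and the [EtTh]-side reduction `prop13_iii_of_cycRigidityCoincide`: by [EtTh] Lemma 5.9 (v) (L2-t4's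
  named statement `ThetaFrobenioid.CycRigidityCoincide`, "the cyclotomic rigidity isomorphism arising from the
  theory of §2 [Cor. 2.19 (i)] coincides with the Frobenioid-theoretic isomorphism of Proposition 5.5 [where
  we take '`S`' to be `B_N`]") the isomorphism `(*mono-Θ)` read in `𝒞`'s cyclotomes IS the Kummer-determined
  `ρ_{B_N}` of [EtTh] Prop. 5.5, so (iii) is EQUIVALENT (`prop13_iii_iff_bsGal_read_eq_rho`) to the single
  equation "`(*bs-Gal)` read in `𝒞`'s cyclotomes `= ρ_{B_N}`" — the [FrdII] Thm. 2.4 (ii) / [AbsTopIII]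
  Rmk. 3.2.1 compatibility the lead-in sentence of Prop. 1.3 cites ("compatible with a certain cyclotomic
  rigidity isomorphism that arises in the theory of [AbsTopIII] [cf. also [FrdII], Theorem 2.4, (ii)]").
  That residual equation is the "conventional scheme theory" input of the printed proof; it is NOT proved
  here and NOT introduced as a `def … : Prop` (it is a hypothesis of the theorems, reported on
  plan/GAP-LEDGER.md by this seat).

HONEST FRAMING: bookkeeping between abc-iut-L6-t1's typing of [IUTchII] Prop. 1.3 and abc-iut-L2-t4's typing
of [EtTh] §5; the [IUTchII] sentences are transcribed under the claim key `Mochizuki2012` (D-0012, disputed);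
nothing here bears on [IUTchIII] Cor. 3.12 and no side is taken; typed ≠ discharged except for the `theorem`s
below, whose hypotheses are listed by name.
-/

namespace Literature.IUT.HodgeArakelov

open CategoryTheory
open Literature.AnabelianGeometry.EtaleTheta

universe w u

variable {S : ThetaSetting.{u}}

/-! ## (i), interior side: a subgroup-with-projection of `Aut(S^bs)` is a subquotient -/

/-- **IUTchII:Prop1.3(i)**, interior cyclotome, the [EtTh] p. 327 shape made to fit abc-iut-L6-t1's
`Subquotient`: for a subgroup `P ⊆ A` (`A = Aut_𝒟(S^bs)`) and a surjection `π : P ↠ L` (L2-t4's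
`ThetaSubquotientProj`: "the preimage of `(l·Δ_Θ)_E ⊆ Aut^Θ_𝒟(E)` in `Aut_𝒟(E)`" and "the projection onto the
subquotient `(l·Δ_Θ)_E`", composed with `(l·Δ_Θ)_E ↠ (l·Δ_Θ)_E ⊗ ℤ/Nℤ`), the pair `(P, Ker π)` is a subquotient
of `A` whose carrier `P / Ker π` is isomorphic to `L` compatibly with `π` — PROVED (first isomorphism
theorem). [claim: Mochizuki2012, status: disputed] -/
theorem subquotient_of_projection {A : Type u} [Group A] (P : Subgroup A) {L : Type w} [Group L]
    (π : P →* L) (hπ : Function.Surjective π) :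
    ∃ (Q : Subquotient A) (e : Q.carrier ≃* L), Q.top = P ∧ Q.bot = π.ker.map P.subtype ∧
      ∀ (x : A) (hx : x ∈ Q.top), ∃ hx' : x ∈ P, e (QuotientGroup.mk ⟨x, hx⟩) = π ⟨x, hx'⟩ := by
  classical
  have hk : (π.ker.map P.subtype).subgroupOf P = π.ker :=
    Subgroup.comap_map_eq_self_of_injective P.subtype_injective _
  have hle : π.ker.map P.subtype ≤ P := by
    rintro _ ⟨y, _, rfl⟩
    exact y.2
  have hn : ((π.ker.map P.subtype).subgroupOf P).Normal := by
    rw [hk]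
    infer_instance
  let Q : Subquotient A := ⟨P, π.ker.map P.subtype, hle, hn⟩
  haveI : (Q.bot.subgroupOf Q.top).Normal := Q.normal
  let e : Q.carrier ≃* L :=
    (QuotientGroup.quotientMulEquivOfEq hk).trans (QuotientGroup.quotientKerEquivOfSurjective π hπ)
  refine ⟨Q, e, rfl, rfl, fun x hx => ⟨hx, ?_⟩⟩
  change (QuotientGroup.quotientKerEquivOfSurjective π hπ)
      (QuotientGroup.quotientMulEquivOfEq hk (QuotientGroup.mk ⟨x, hx⟩)) = π ⟨x, hx⟩
  rw [QuotientGroup.quotientMulEquivOfEq_mk]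
  rfl

/-! ## (i), exterior side: `Ker(E^Π_N ↠ Π^tp_Y̲) = μ_N(B_N)` as a group isomorphism ([EtTh] Rmk. 5.10.3) -/

/-- **IUTchII:Prop1.3(i)**, exterior cyclotome ("the exterior cyclotome `Π_μ(M^Θ(𝒞))` corresponds to the
subgroup `μ_N(S) ⊆ O^×(S) ⊆ Aut(S)`", kurims p. 26; [EtTh] Rmk. 5.10.3 "the distinct cyclotome"
`μ_N(B_N) ≅ Ker(E^Π_N ↠ Π^tp_Y)`): for the [EtTh] §5 group `E^Π_N = E_N ×_{Im(Π^tp_Y̲)} Π^tp_Y̲` of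
abc-iut-L2-t4 (`ThetaFrobenioid.EPiN`), the kernel of `E^Π_N ↠ Π^tp_Y̲` is isomorphic to
`μ_N(B_N) = ThetaFrobenioid.muTorsion B_N N ⊆ O^×(B_N) ⊆ Aut_𝒞(B_N)` by an isomorphism `e` with
`(e x, 1) = x` — PROVED from L2-t4's `toPiY_ker` (modulo the section property `SgpCapSection` of `s^⊓-gp_N`,
[EtTh] Prop. 4.3 (i), the hypothesis under which L2-t4 proves Lemma 5.9 (ii)) and the injectivity of
`u ↦ (u, 1)`. [cite: MochizukiEtTh2009, Rmk 5.10.3 p.336 (PDF p.110)] -/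
theorem exists_kerToPiY_mulEquiv_muTorsion {C : Type (u + 1)} [Category.{u} C] {D : Type (u + 1)}
    [Category.{u} D] (𝔉 : ThetaFrobenioid.{w} C D) (hsec : 𝔉.SgpCapSection) :
    ∃ e : 𝔉.toPiY.ker ≃* 𝔉.muTorsion 𝔉.BN 𝔉.N,
      ∀ x : 𝔉.toPiY.ker, (((e x : 𝔉.muTorsion 𝔉.BN 𝔉.N) : Aut 𝔉.BN), (1 : 𝔉.PiX)) =
        ((x : 𝔉.EPiN) : Aut 𝔉.BN × 𝔉.PiX) := by
  have hinj : Function.Injective 𝔉.muIncl := by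
    intro u v h
    have h' := congrArg (fun y : 𝔉.EPiN => ((y : Aut 𝔉.BN × 𝔉.PiX)).1) h
    simp only [ThetaFrobenioid.coe_muIncl] at h'
    exact Subtype.ext h'
  refine ⟨(MulEquiv.subgroupCongr (𝔉.toPiY_ker hsec)).trans (MonoidHom.ofInjective hinj).symm,
    fun x => ?_⟩
  have hx : (x : 𝔉.EPiN) ∈ 𝔉.muIncl.range := by
    rw [← 𝔉.toPiY_ker hsec]
    exact x.2
  obtain ⟨u, hu⟩ := hx
  have he : (MonoidHom.ofInjective hinj).symm (MulEquiv.subgroupCongr (𝔉.toPiY_ker hsec) x) = u := by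
    apply (MonoidHom.ofInjective hinj).injective
    rw [MulEquiv.apply_symm_apply]
    apply Subtype.ext
    rw [MonoidHom.ofInjective_apply, hu]
    rfl
  rw [MulEquiv.trans_apply, he, ← hu, ThetaFrobenioid.coe_muIncl]

/-! ## (i) + (ii): existence of the Prop. 1.3 data (`Prop13_i_ii`) -/

/-- **IUTchII:Prop1.3(i)** and **IUTchII:Prop1.3(ii)**, existence of the typed data `FrobenioidCyclotomes E`,
`BsGalData Z` (abc-iut-L6-t1's `Prop13_i_ii E`) from inputs of exactly the printed shape: an object `S` of
`𝒞` with subgroups `μ ⊆ U ⊆ Aut_𝒞(S)` ("`μ_N(S) ⊆ O^×(S) ⊆ Aut(S)`") and an identification of the exterior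
cyclotome `Π_μ(M^Θ(𝒞))` with `μ`; a subgroup `P ⊆ Aut_𝒟(S^bs)` with a surjection `π : P ↠ L` ("a certain
subquotient of `Aut(S^bs)` … `(l·Δ_Θ)_S ⊗ (ℤ/Nℤ)`", [EtTh] p. 327) and an identification of
`(l·Δ_Θ)(M^Θ(𝒞)) ⊗ ℤ/Nℤ` with `L`; and the [AbsTopIII] data of (ii): mod-`N` cyclotomes `μ_Ẑ(M_TM)`, `μ_Ẑ(G_k)`,
`μ_Ẑ(Π_X)` with "the natural isomorphism `μ_Ẑ(G_k) ⥲ μ_Ẑ(Π_X)` of [AbsTopIII], Corollary 1.10, (c)" (`i₁`),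
"the natural isomorphism `μ_Ẑ(M_TM) ⥲ μ_Ẑ(G)` of [AbsTopIII], Remark 3.2.1" (`i₂`) and the two printed
correspondences (`c₁`: "`μ_N(S)` corresponds to `μ_Ẑ(M_TM) ⊗ (ℤ/Nℤ)`", `c₂`: "`(l·Δ_Θ)_S ⊗ (ℤ/Nℤ)` corresponds to
`μ_Ẑ(Π_X) ⊗ (ℤ/Nℤ)`") — PROVED: the subquotient is `(P, Ker π)` (`subquotient_of_projection`), `μ_N(S) := μ`,
`O^×(S) := U`. The [AbsTopIII] inputs are PARAMETERS (see the module docstring: the tree's Cor. 1.10 (ii)(c)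
does not single out the natural isomorphism). [claim: Mochizuki2012, status: disputed] -/
theorem prop13_i_ii_of_cyclotome_data {F : TemperedFrobenioidData S} (E : EnvOfFrobenioid F)
    (obj : F.C) (U μ : Subgroup (Aut obj)) (hμ : μ ≤ U) (eExt : E.recon.extCyc ≃* μ)
    (P : Subgroup (Aut (F.base.obj obj))) {L : Type w} [Group L] (π : P →* L)
    (hπ : Function.Surjective π) (eInt : ModPow E.recon.intCyc.carrier (S.N : ℕ) ≃* L)
    {MTM Gc PX : Type u} [Group MTM] [Group Gc] [Group PX]
    (i₁ : Gc ≃* PX) (i₂ : MTM ≃* Gc) (c₁ : μ ≃* MTM) (c₂ : L ≃* PX) :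
    Prop13_i_ii E := by
  obtain ⟨Q, e, -, -, -⟩ := subquotient_of_projection P π hπ
  let Z : FrobenioidCyclotomes E :=
    { obj := obj
      intS := Q
      muN := μ
      unitsS := U
      muN_le := hμ
      corrInt := eInt.trans e.symm
      corrExt := eExt }
  let B : BsGalData Z :=
    { muMTM := MTM
      muG := Gc
      muPiX := PX
      corGk_PiX := i₁
      corMTM_G := i₂
      corr_muN := c₁
      corr_intS := e.trans c₂ }
  exact ⟨Z, ⟨B⟩⟩

/-- **IUTchII:Prop1.3(i)**–**(ii)** over the [EtTh] §5 data of abc-iut-L2-t4 (`ThetaFrobenioid 𝔉` on the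
categories `𝒞`, `𝒟` of the Prop. 1.2 (ii) interface, "[cf. [EtTh], Proposition 5.5; [EtTh], Lemma 5.9, (v)]"
with `S := B_N`): if the exterior cyclotome `Π_μ(M^Θ(𝒞)) = Ker(Π_{M^Θ(𝒞)} ↠ Π_Y)` of the Prop. 1.2 (ii)
output `E` is identified with `Ker(E^Π_N ↠ Π^tp_Y̲)` (`φ` — this is what "the mono-theta environment
`M^Θ(𝒞)` constructed from the tempered Frobenioid `𝒞`", [EtTh] Lemma 5.9 (iv) / Thm. 5.10 (iii), provides:
`M^Θ(𝒞)` is the mono-theta environment structure on `E^Π_N`), and its interior cyclotome mod `N` with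
`(l·Δ_Θ)_{B_N} ⊗ ℤ/Nℤ = ThetaFrobenioid.lDeltaModN B_N` (`ψ`, PARAMETER, owner abc-iut-L2-t2) realised as the
subquotient `P ↠ (l·Δ_Θ)_{B_N} ⊗ ℤ/Nℤ` of `Aut_𝒟(B_N^bs)` (`P`, `π`: L2-t4's `ThetaSubquotientProj` at `B_N^bs`
followed by reduction mod `N`), then — given the [AbsTopIII] data of (ii) as in
`prop13_i_ii_of_cyclotome_data` — `Prop13_i_ii E` holds with `μ_N(S) := ThetaFrobenioid.muTorsion B_N N`,
`O^×(S) := ThetaFrobenioid.units B_N` ([FrdII] Def. 2.1 (i) / [EtTh] Def. 5.4, REAL definitions of L2-t4) and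
the exterior correspondence COMPUTED by `exists_kerToPiY_mulEquiv_muTorsion`. Hypothesis `hsec`: [EtTh]
Prop. 4.3 (i), the section property of `s^⊓-gp_N` (L2-t4's `SgpCapSection`).
[claim: Mochizuki2012, status: disputed] -/
theorem prop13_i_ii_of_thetaFrobenioid {F : TemperedFrobenioidData S} (E : EnvOfFrobenioid F)
    (𝔉 : ThetaFrobenioid.{w} F.C F.D) (hsec : 𝔉.SgpCapSection)
    (φ : E.recon.extCyc ≃* 𝔉.toPiY.ker)
    (P : Subgroup (Aut (F.base.obj 𝔉.BN))) (π : P →* 𝔉.lDeltaModN 𝔉.BN)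
    (hπ : Function.Surjective π) (ψ : ModPow E.recon.intCyc.carrier (S.N : ℕ) ≃* 𝔉.lDeltaModN 𝔉.BN)
    {MTM Gc PX : Type u} [Group MTM] [Group Gc] [Group PX]
    (i₁ : Gc ≃* PX) (i₂ : MTM ≃* Gc) (c₁ : 𝔉.muTorsion 𝔉.BN 𝔉.N ≃* MTM)
    (c₂ : 𝔉.lDeltaModN 𝔉.BN ≃* PX) :
    Prop13_i_ii E := by
  obtain ⟨e, -⟩ := exists_kerToPiY_mulEquiv_muTorsion 𝔉 hsec
  exact prop13_i_ii_of_cyclotome_data E 𝔉.BN (𝔉.units 𝔉.BN) (𝔉.muTorsion 𝔉.BN 𝔉.N)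
    (𝔉.muTorsion_le_units 𝔉.BN 𝔉.N) (φ.trans e) P π hπ ψ i₁ i₂ c₁ c₂

/-- Transport of a subgroup-with-surjection along an isomorphism of ambient groups (used to move L2-t4's
`ThetaSubquotientProj` datum on `Aut_𝒟(B_N^bs)` across an identification of base objects): if `P ⊆ A` surjects
onto `L` by `π`, then `e(P) ⊆ A'` surjects onto `L` by `π ∘ e⁻¹`. Elementary group theory.
[claim: Mochizuki2012, status: disputed] -/
theorem exists_projection_map_of_mulEquiv {A A' : Type u} [Group A] [Group A'] (t : A ≃* A')
    (P : Subgroup A) {L : Type w} [Group L] (π : P →* L) (hπ : Function.Surjective π) :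
    ∃ π' : P.map (t : A →* A') →* L, Function.Surjective π' ∧
      ∀ x : P, π' (t.subgroupMap P x) = π x := by
  refine ⟨π.comp (t.subgroupMap P).symm.toMonoidHom, ?_, fun x => ?_⟩
  · exact hπ.comp (t.subgroupMap P).symm.surjective
  · change π ((t.subgroupMap P).symm (t.subgroupMap P x)) = π x
    rw [MulEquiv.symm_apply_apply]

/-- **IUTchII:Prop1.3(i)**–**(ii)** with the interior subquotient SOURCED from abc-iut-L2-t4's
`ThetaSubquotientProj 𝔉` ([EtTh] p. 327: "these subquotients determine subquotients `Aut_𝒟(D) ↠ Aut^Θ_𝒟(D)`;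
`(l·Δ_Θ)_D ⊆ Aut^Θ_𝒟(D)`" — the preimage `P_E ⊆ Aut_𝒟(E)` and the projection `P_E ↠ (l·Δ_Θ)_E`) at `E = B_N^bs`,
followed by reduction mod `N` onto `(l·Δ_Θ)_{B_N} ⊗ ℤ/Nℤ`. Hypothesis `hobj`: the base functor of the Prop. 1.2
(ii) interface and that of the [EtTh] §5 data agree on `B_N` ("whose image in `𝒟` we denote by `S^bs`";
automatic at merge, when `F.base` IS `𝔉.base`); the subquotient is moved along `Aut(𝔉.base B_N) ≅ Aut(F.base B_N)`
(`Iso.conjAut` of the resulting `eqToIso`). Remaining PARAMETERS as in `prop13_i_ii_of_thetaFrobenioid`: `φ`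
(exterior cyclotome of `M^Θ(𝒞)` = `Ker(E^Π_N ↠ Π^tp_Y̲)`), `ψ` (interior cyclotome mod `N` = `(l·Δ_Θ)_{B_N} ⊗ ℤ/Nℤ`,
owner abc-iut-L2-t2) and the [AbsTopIII] data of (ii). [claim: Mochizuki2012, status: disputed] -/
theorem prop13_i_ii_of_thetaSubquotientProj {F : TemperedFrobenioidData S} (E : EnvOfFrobenioid F)
    (𝔉 : ThetaFrobenioid.{w} F.C F.D) (hsec : 𝔉.SgpCapSection)
    (Pj : FrobenioidCyclotomicRigidity.ThetaSubquotientProj 𝔉)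
    (hobj : 𝔉.base.obj 𝔉.BN = F.base.obj 𝔉.BN)
    (φ : E.recon.extCyc ≃* 𝔉.toPiY.ker)
    (ψ : ModPow E.recon.intCyc.carrier (S.N : ℕ) ≃* 𝔉.lDeltaModN 𝔉.BN)
    {MTM Gc PX : Type u} [Group MTM] [Group Gc] [Group PX]
    (i₁ : Gc ≃* PX) (i₂ : MTM ≃* Gc) (c₁ : 𝔉.muTorsion 𝔉.BN 𝔉.N ≃* MTM)
    (c₂ : 𝔉.lDeltaModN 𝔉.BN ≃* PX) :
    Prop13_i_ii E := by
  -- the projection `P_{B_N^bs} ↠ (l·Δ_Θ)_{B_N} ↠ (l·Δ_Θ)_{B_N} ⊗ ℤ/Nℤ`, surjective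
  let π₀ : Pj.pre (𝔉.base.obj 𝔉.BN) →* 𝔉.lDeltaModN 𝔉.BN :=
    (QuotientGroup.mk' _).comp (Pj.proj (𝔉.base.obj 𝔉.BN))
  have hπ₀ : Function.Surjective π₀ :=
    (QuotientGroup.mk'_surjective _).comp (Pj.proj_surjective _)
  -- move it along `Aut(𝔉.base B_N) ≅ Aut(F.base B_N)`
  let t : Aut (𝔉.base.obj 𝔉.BN) ≃* Aut (F.base.obj 𝔉.BN) := (eqToIso hobj).conjAut
  obtain ⟨π, hπ, -⟩ := exists_projection_map_of_mulEquiv t (Pj.pre (𝔉.base.obj 𝔉.BN)) π₀ hπ₀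
  exact prop13_i_ii_of_thetaFrobenioid E 𝔉 hsec φ _ π hπ ψ i₁ i₂ c₁ c₂

/-! ## (iii): the coincidence `(*mono-Θ) = (*bs-Gal)` -/

/-- **IUTchII:Prop1.3(iii)** unfolded: the typed predicate `Prop13_iii C Z B` is the pointwise equation
`(*mono-Θ) = (*bs-Gal)` on `(l·Δ_Θ)_S ⊗ (ℤ/Nℤ)`. [claim: Mochizuki2012, status: disputed] -/
theorem prop13_iii_iff {F : TemperedFrobenioidData S} {E : EnvOfFrobenioid F}
    (C : CyclotomicRigidity E.recon) (Z : FrobenioidCyclotomes E) (B : BsGalData Z) :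
    Prop13_iii C Z B ↔ ∀ x, Z.monoTheta C x = B.bsGal x :=
  MulEquiv.ext_iff

/-- **IUTchII:Prop1.3(iii)**, the printed inference (p. 27: "both isomorphisms `(*mono-Θ)`, `(*bs-Gal)` coincide
with the conventional identification between the cyclotomes involved that arises from conventional scheme
theory" ⇒ they coincide) — PROVED: if `a : (l·Δ_Θ)_S ⊗ (ℤ/Nℤ) ⥲ ν` and `b : μ_N(S) ⥲ ν` are identifications
with one reference cyclotome `ν` ("the conventional identification") and both `(*mono-Θ)` and `(*bs-Gal)`
become the identity of `ν` under `(a, b)`, then `Prop13_iii C Z B`. The two hypotheses `hmono`, `hgal` ARE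
the scheme-theoretic inputs of the printed proof (not proved here; for `(*mono-Θ)` see
`prop13_iii_of_cycRigidityCoincide`). [claim: Mochizuki2012, status: disputed] -/
theorem prop13_iii_of_conventional {F : TemperedFrobenioidData S} {E : EnvOfFrobenioid F}
    (C : CyclotomicRigidity E.recon) (Z : FrobenioidCyclotomes E) (B : BsGalData Z)
    {ν : Type w} [Group ν] (a : Z.intS.carrier ≃* ν) (b : Z.muN ≃* ν)
    (hmono : ∀ x, b (Z.monoTheta C x) = a x) (hgal : ∀ x, b (B.bsGal x) = a x) :
    Prop13_iii C Z B := by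
  rw [prop13_iii_iff]
  intro x
  apply b.injective
  rw [hmono, hgal]

/-- **IUTchII:Prop1.3(i)**/**(iii)** bookkeeping: `(*mono-Θ)` READ IN `𝒞`'S OWN CYCLOTOMES. Given identifications
`a : (l·Δ_Θ)_S ⊗ ℤ/Nℤ ⥲ (l·Δ_Θ)_{B_N} ⊗ ℤ/Nℤ` (L2-t4's `lDeltaModN B_N`) and `b : μ_N(S) ⥲ μ_N(B_N)` (L2-t4's
`muTorsion B_N N`) of abc-iut-L6-t1's Frobenioid-theoretic cyclotomes with abc-iut-L2-t4's, the Def. 1.1 (ii)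
isomorphism "takes the form of an isomorphism `(l·Δ_Θ)_S ⊗ (ℤ/Nℤ) ⥲ μ_N(S)`" (kurims p. 26), namely
`a⁻¹ ≫ (*mono-Θ) ≫ b : (l·Δ_Θ)_{B_N} ⊗ ℤ/Nℤ ⥲ μ_N(B_N)` — the slot `ρ219` ("the cyclotomic rigidity isomorphism
arising from the theory of §2 [cf. Corollary 2.19, (i)]") of L2-t4's [EtTh] Lemma 5.9 (v) statement
`ThetaFrobenioid.CycRigidityCoincide`; PROVED: [EtTh] Lemma 5.9 (v) for this slot says precisely that the
Prop. 5.5 isomorphism `ρ_{B_N}` computes `(*mono-Θ)`: `b ((*mono-Θ) x) = ρ_{B_N} (a x)`.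
[cite: MochizukiEtTh2009, Lem 5.9 (v) p.332 (PDF p.106)] -/
theorem monoTheta_read_eq {F : TemperedFrobenioidData S} {E : EnvOfFrobenioid F}
    (𝔉 : ThetaFrobenioid.{w} F.C F.D) (hB : 𝔉.IsThetaSaturated 𝔉.BN)
    (ρ : FrobenioidCyclotomicRigidity.RigidityFamily 𝔉)
    (C : CyclotomicRigidity E.recon) (Z : FrobenioidCyclotomes E)
    (a : Z.intS.carrier ≃* 𝔉.lDeltaModN 𝔉.BN) (b : Z.muN ≃* 𝔉.muTorsion 𝔉.BN 𝔉.N)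
    (h59v : 𝔉.CycRigidityCoincide (a.symm.trans ((Z.monoTheta C).trans b)) ρ hB) (x : Z.intS.carrier) :
    b (Z.monoTheta C x) = ρ 𝔉.BN hB (a x) := by
  unfold ThetaFrobenioid.CycRigidityCoincide at h59v
  rw [h59v]
  simp

/-- **IUTchII:Prop1.3(iii)** reduced to [EtTh] Lemma 5.9 (v) plus ONE residual equation — PROVED: with
`a`, `b` as in `monoTheta_read_eq` and [EtTh] Lemma 5.9 (v) for the slot `a⁻¹ ≫ (*mono-Θ) ≫ b` (L2-t4's
`CycRigidityCoincide`, hypothesis `h59v`), `Prop13_iii C Z B` is EQUIVALENT to "`(*bs-Gal)` read in `𝒞`'s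
cyclotomes equals the Frobenioid-theoretic, Kummer-determined isomorphism `ρ_{B_N}` of [EtTh] Prop. 5.5":
`∀ x, b ((*bs-Gal) x) = ρ_{B_N} (a x)`. That equation — "[AbsTopIII]'s cyclotomic rigidity via MLF-Galois
pairs agrees with the Kummer/bi-Kummer one of the Frobenioid", the compatibility the lead-in of Prop. 1.3 cites
as "[cf. also [FrdII], Theorem 2.4, (ii)]" and the printed proof calls "the conventional identification …
from conventional scheme theory" — is the exact residual input of node `IUTchII:Prop1.3(iii)`; it is NOT
proved here and NOT typed as a fact (reported to plan/GAP-LEDGER.md). [claim: Mochizuki2012, status: disputed] -/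
theorem prop13_iii_iff_bsGal_read_eq_rho {F : TemperedFrobenioidData S} {E : EnvOfFrobenioid F}
    (𝔉 : ThetaFrobenioid.{w} F.C F.D) (hB : 𝔉.IsThetaSaturated 𝔉.BN)
    (ρ : FrobenioidCyclotomicRigidity.RigidityFamily 𝔉)
    (C : CyclotomicRigidity E.recon) (Z : FrobenioidCyclotomes E) (B : BsGalData Z)
    (a : Z.intS.carrier ≃* 𝔉.lDeltaModN 𝔉.BN) (b : Z.muN ≃* 𝔉.muTorsion 𝔉.BN 𝔉.N)
    (h59v : 𝔉.CycRigidityCoincide (a.symm.trans ((Z.monoTheta C).trans b)) ρ hB) :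
    Prop13_iii C Z B ↔ ∀ x, b (B.bsGal x) = ρ 𝔉.BN hB (a x) := by
  rw [prop13_iii_iff]
  refine ⟨fun h x => ?_, fun h x => ?_⟩
  · rw [← h x, monoTheta_read_eq 𝔉 hB ρ C Z a b h59v x]
  · apply b.injective
    rw [h x, monoTheta_read_eq 𝔉 hB ρ C Z a b h59v x]

/-- **IUTchII:Prop1.3(iii)** PROVED MODULO its two named inputs: [EtTh] Lemma 5.9 (v) (`h59v`, L2-t4's
`CycRigidityCoincide` for the slot `a⁻¹ ≫ (*mono-Θ) ≫ b`) and the residual equation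
"`(*bs-Gal)` read in `𝒞`'s cyclotomes `= ρ_{B_N}`" (`hgal`, see `prop13_iii_iff_bsGal_read_eq_rho`).
[claim: Mochizuki2012, status: disputed] -/
theorem prop13_iii_of_cycRigidityCoincide {F : TemperedFrobenioidData S} {E : EnvOfFrobenioid F}
    (𝔉 : ThetaFrobenioid.{w} F.C F.D) (hB : 𝔉.IsThetaSaturated 𝔉.BN)
    (ρ : FrobenioidCyclotomicRigidity.RigidityFamily 𝔉)
    (C : CyclotomicRigidity E.recon) (Z : FrobenioidCyclotomes E) (B : BsGalData Z)
    (a : Z.intS.carrier ≃* 𝔉.lDeltaModN 𝔉.BN) (b : Z.muN ≃* 𝔉.muTorsion 𝔉.BN 𝔉.N)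
    (h59v : 𝔉.CycRigidityCoincide (a.symm.trans ((Z.monoTheta C).trans b)) ρ hB)
    (hgal : ∀ x, b (B.bsGal x) = ρ 𝔉.BN hB (a x)) :
    Prop13_iii C Z B :=
  (prop13_iii_iff_bsGal_read_eq_rho 𝔉 hB ρ C Z B a b h59v).mpr hgal

/-- **IUTchII:Prop1.3(iii)**, the definitional content of `(*bs-Gal)`: the typed predicate says exactly that
`(*mono-Θ) = corrInt⁻¹ ≫ (Def. 1.1 (ii)) ≫ corrExt` equals the printed composite
"`(l·Δ_Θ)_S ⊗ ℤ/Nℤ → μ_Ẑ(Π_X) → μ_Ẑ(G_k) → μ_Ẑ(M_TM) → μ_N(S)` (inverses of the two natural isomorphisms composed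
with the correspondences)" — `Iff.rfl`-level bookkeeping recorded so that consumers can rewrite either side.
[claim: Mochizuki2012, status: disputed] -/
theorem prop13_iii_iff_composites {F : TemperedFrobenioidData S} {E : EnvOfFrobenioid F}
    (C : CyclotomicRigidity E.recon) (Z : FrobenioidCyclotomes E) (B : BsGalData Z) :
    Prop13_iii C Z B ↔
      ∀ x, Z.corrExt (C.iso (Z.corrInt.symm x)) =
        B.corr_muN.symm (B.corMTM_G.symm (B.corGk_PiX.symm (B.corr_intS x))) := by
  rw [prop13_iii_iff]
  rfl

end Literature.IUT.HodgeArakelov
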